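import Summits.QuantumFields.YangMills.Theorems.BalabanUVNodesN19ResponseRoadAtScheme
import Literature.MathematicalPhysics.QuantumFieldTheory.Balaban1983to89.Node00.Record13SepCoPHV
import Summits.QuantumFields.YangMills.Theses.BalabanUVNodes

/-!
# BalabanUVNodes ∕ N19 (NE7 proper) — THE LIVE CRUX K3⁸ `SpineGivenEndpointR13SepCoPHV` (stmt-QuantumFields-27366) READ IN KING SHAPE: at every guarded admissible Stage-13 tuple
# AND EVERY VERSION SLOT `v`, binder B5 of the slot datum ⟺ node U5's DECL target `T4ApexVariance.MatchingUnder` (per-string matching of the dressed partition functions modulo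
# constants with a summable remainder) — so K3⁸ ⟺ «`MatchingUnder (datumOfRecord₁₃SepCoPHV F 2 θ h v) END` for all guarded admissible `(θ, h, v)`», and, the Wilson schemes and the
# tuned window being version-free (`rfl`), ⟺ per-string `Spine.NE7.Target`s of the RECORD's schemes along the RECORD's tuned window, asked under (B) at every slot

Cell `pub-ymgap` (HUMAN RULING D-0062 Track A ∕ D-0149 width seats), WIDTH SEAT `pub-ymgap-dag-n19-w2` (node n19 = NE7, seat 2 of 3), generation g8, CLAIM-4 ∕ INTENT-4.  This file
imports the route file BECAUSE its theorems carry the route decl `Summit.QuantumFields.YangMills.Theses.BalabanUVNodes.SpineGivenEndpointR13SepCoPHV` in their TYPE (director LINE №103 (1)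
rule; nothing imports this file).  Filed `--kind proof --supports stmt-QuantumFields-27366 --as helper`.  COUNT-NEUTRAL.  NO theorem below has the bare item as its type (all are `… →
SpineGivenEndpointR13SepCoPHV`, `SpineGivenEndpointR13SepCoPHV → …` or `↔`); NOTHING IS CLAIMED.  THEOREMS ONLY (0 `def`, 0 `sorry`); imports this seat's g7∕g8 FILE J
`…N19ResponseRoadAtScheme` v1.1 (p639416: `hybridNE7Under_iff_stringTargetsUnder`, and through it dag-n23-b's `…Balaban1983to89.T4MatchingDegenerate.hybridNE7Under_iff_matchingUnder`),
DEF-1's `…Node00.Record13SepCoPHV` (p620607: `datumOfRecord₁₃SepCoPHV`, `isPrintedAveraged_datumOfRecord₁₃SepCoPHV`, the `rfl` faces `scheme_…` ∕ `underHypotheses_…_iff`) and the route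
file — all BY NAME; edits nothing, re-declares nothing.  The K3⁷ twin (predecessor item 20544, datum `datumOfRecord₁₃SepCoPH`) is dag-n19-d's `…N19TargetK3R13SepCoPHReading`
(`spineGivenEndpointR13SepCoPH_iff_forall_guarded_matchingUnder`); this is its (δⱽ)-image at the slot datum, which the tree did not yet carry (`rg 'SepCoPHV.*MatchingUnder'` = FILE J only).

WHY (the erratum of FILE J v1.1, carried to the crux).  K3⁸ concludes `T4ApexHybrid.HybridNE7Under (datumOfRecord₁₃SepCoPHV F 2 θ h v) END` — binder B5 of the rung `BalabanLadder.UV` at the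
SLOT datum.  B5 quantifies the hybrid datum EXISTENTIALLY over its class index (`T4MatchingAssembly.StringHybridNE7`), so by the degenerate one-class expansion it is EQUIVALENT to node U5's
King-shape output `MatchingUnder` (dag-n23-b; the slot datum is printed-averaged, `isPrintedAveraged_datumOfRecord₁₃SepCoPHV`, so no measurability hypothesis is left).  Hence (§2) the crux
ITSELF is `Target`-level: it asks, at every guarded admissible tuple and slot, per-string matching of consecutive dressed partition functions modulo `t`-independent constants with a summable
remainder — NO class decomposition, NO bad class, NO shell, NO class-uniform constant (`Hom`).  The `Core`-at-the-pinned-key content that the crux card `window-key-core` shows unsatisfiable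
enters only through the registered LINE «v6» (stub 2's `PinnedAtLive … cr = crOfRecord₁₃V` + `KeyedCoreEdgeHolderD4V`), not through the crux statement: a `Target`-typed stub 2 — e.g. this
seat's response ∕ decorrelation road (FILES C–M, J) or any per-string `Target` producer — closes K3⁸ LITERALLY via §2∕§3.  §4 displays the statement slot-free in its body: the Wilson schemes
`(datumOfRecord₁₃SepCoPHV … v).scheme g₀ = (datumOfRecord₁₃SepCoPH …).scheme g₀` and the tuned window are version-free by `rfl` (DEF-1), so only the antecedent (B) reads the slot.

WHAT IS PROVED ([bookkeeping] BY NAME; `N = 2` as in the item).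
* §1 ★ `hybridNE7Under_datumOfRecord₁₃SepCoPHV_iff_matchingUnder` (θ,h,v-keyed, any β-binder `Hβ`: B5 at the slot datum ⟺ `MatchingUnder` at the slot datum).
* §2 ★ `matchingUnder_datumOfRecord₁₃SepCoPHV_of_spineGivenEndpointR13SepCoPHV` · ★ `spineGivenEndpointR13SepCoPHV_of_forall_guarded_matchingUnder` · ★★★
  `spineGivenEndpointR13SepCoPHV_iff_forall_guarded_matchingUnder` — THE READING: K3⁸ ⟺ «for every family, every Stage-13 tuple `θ` with provisos `Provisos₁₃SepCoPH`, guard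
  `θ.ZhUnity F 2 ∧ θ.SlotsNondegenerate₁₃ F 2`, admissible, and EVERY version slot `v`: `MatchingUnder (datumOfRecord₁₃SepCoPHV F 2 θ h v) END`» (the item's displayed `(B) → END →`
  prefix is absorbed — `MatchingUnder … END` carries its own).
* §3 in `Spine.NE7.Target` letters: ★★ `spineGivenEndpointR13SepCoPHV_iff_forall_guarded_stringTargetsUnder` (per-string targets under the prefix, each string its own radius; FILE J v1.1
  `hybridNE7Under_iff_stringTargetsUnder`) · ★ `spineGivenEndpointR13SepCoPHV_of_forall_guarded_targetsUnder` (the uniform-radius form FILE J §3∕§5 consumes).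
* §4 ★★ `spineGivenEndpointR13SepCoPHV_iff_slotAntecedent_recordBody` — the statement with its BODY DISPLAYED SLOT-FREE: K3⁸ ⟺ ∀ guarded admissible `(θ, h)`, ∀ `v`, (B) at the slot datum
  → END → `∃ γ₀ > 0, ∀ γ ∈ ]0, γ₀], ∃ g₁ > 0, ∀ g ∈ ]0, g₁], ∀ g₀, (datumOfRecord₁₃SepCoPH F 2 θ h).Tuned γ g g₀ →` every string of the RECORD's scheme `(datumOfRecord₁₃SepCoPH F 2 θ h).scheme g₀`
  has `∃ l₀ > 0, vol, δ: Spine.NE7.Target vol l₀ δ (schemeZ … os)` (DEF-1's `underHypotheses_datumOfRecord₁₃SepCoPHV_iff` + `scheme_datumOfRecord₁₃SepCoPHV`, both `rfl`).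

HONEST FRAMING.  Bookkeeping BY NAME (degenerate expansion + DEF-1's `rfl` faces); proves NO estimate; per-string targets ∕ `MatchingUnder` are produced by nobody for any tuple (A6: the right-hand
sides are HYPOTHESIS SHAPES, inhabited for no family today; K1⁹'s witness question untouched); NE7 NOT PRINTED for d = 4 ([Balaban1989LargeFieldII] Thm 1 p.355 is ultraviolet stability of ONE
run, not matching of consecutive cutoffs) and NOT proved; N19 NOT discharged; K3⁸ 27366 OPEN, NOT claimed, no registered stub touched, skeleton «v6» b4e55110ab73e679 untouched; the rung
`BalabanLadder.UV` NOT touched; counts UNMOVED (typed 28∕28 · discharged 5∕27, A 5∕28); no count claim.  One finite four-torus programme at fixed `ε`, Bałaban AS PRINTED; R4 closes the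
conditional finite-𝕋⁴ rung `BalabanLadder.UV` only — NOT ℝ⁴, NOT infinite volume, NOT OS, NOT the Yang–Mills mass gap, NOT Clay.  0 `def`; 0 `sorry`; standard axioms.
-/

set_option autoImplicit false

noncomputable section

namespace Summit.QuantumFields.YangMills.BalabanUVNodes.N19TargetK3R13SepCoPHVReading

open Literature.MathematicalPhysics.QuantumFieldTheory.Balaban1983to89
open Literature.MathematicalPhysics.QuantumFieldTheory.Balaban1983to89.T4Continuum (T4Family FiniteEpsData ULoop)
open Literature.MathematicalPhysics.QuantumFieldTheory.Balaban1983to89.Node00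
open Literature.MathematicalPhysics.QuantumFieldTheory.Balaban1983to89.T4ApexVariance (MatchingUnder)
open Summit.QuantumFields.YangMills.Theses.BalabanUVNodes (SpineGivenEndpointR13SepCoPHV)
open Summit.QuantumFields.BalabanUV.T4Continuum.Spine
open Summit.QuantumFields.YangMills.BalabanUVNodes.N19ResponseRoadAtScheme (hybridNE7Under_iff_stringTargetsUnder hybridNE7Under_of_targetsUnder)

/-! ## §1 B5 ⟺ `MatchingUnder` at the slot datum (θ, h, v-keyed) -/

/-- ★ **B5 ⟺ NODE U5's KING-SHAPE OUTPUT AT THE SLOT DATUM**, any β-binder `Hβ`: dag-n23-b's `T4MatchingDegenerate.hybridNE7Under_iff_matchingUnder` at `datumOfRecord₁₃SepCoPHV F 2 θ h v`,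
measurability from DEF-1's `isPrintedAveraged_datumOfRecord₁₃SepCoPHV`. [folklore] -/
theorem hybridNE7Under_datumOfRecord₁₃SepCoPHV_iff_matchingUnder {F : T4Family} (θ : Stage13HParams F 2) (h : θ.Provisos₁₃SepCoPH F 2)
    (v : Revision₁₃ F 2 θ h) (Hβ : Prop) :
    T4ApexHybrid.HybridNE7Under (datumOfRecord₁₃SepCoPHV F 2 θ h v) Hβ ↔ MatchingUnder (datumOfRecord₁₃SepCoPHV F 2 θ h v) Hβ :=
  T4MatchingDegenerate.hybridNE7Under_iff_matchingUnder _ (isPrintedAveraged_datumOfRecord₁₃SepCoPHV F 2 θ h v).avgMeasurable Hβ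

/-! ## §2 The reading: K3⁸ ⟺ `MatchingUnder … END` at every guarded admissible tuple and every slot -/

/-- ★ **K3⁸ ⟹ N19's TARGET AT EVERY GUARDED ADMISSIBLE SLOT DATUM** [bookkeeping] (the item's outer `(B)`∕END hypotheses are fed by `MatchingUnder`'s own prefix). [folklore] -/
theorem matchingUnder_datumOfRecord₁₃SepCoPHV_of_spineGivenEndpointR13SepCoPHV (hK : SpineGivenEndpointR13SepCoPHV) (F : T4Family) (θ : Stage13HParams F 2)
    (h : θ.Provisos₁₃SepCoPH F 2) (v : Revision₁₃ F 2 θ h) (hG : θ.ZhUnity F 2 ∧ θ.SlotsNondegenerate₁₃ F 2) (hθ : θ.Admissible F 2) :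
    MatchingUnder (datumOfRecord₁₃SepCoPHV F 2 θ h v) (DagBinding.EndpointExistence (datumOfRecord₁₃SepCoPHV F 2 θ h v).C.toB12) :=
  (hybridNE7Under_datumOfRecord₁₃SepCoPHV_iff_matchingUnder θ h v _).mp fun hB hE => hK F θ h v hG hθ hB hE hB hE

/-- ★ **N19's TARGET AT EVERY GUARDED ADMISSIBLE SLOT DATUM ⟹ K3⁸** [bookkeeping] (the displayed (B)∕END hypotheses are discarded — B5 under END carries its own). [folklore] -/
theorem spineGivenEndpointR13SepCoPHV_of_forall_guarded_matchingUnder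
    (h : ∀ (F : T4Family) (θ : Stage13HParams F 2) (hP : θ.Provisos₁₃SepCoPH F 2) (v : Revision₁₃ F 2 θ hP), θ.ZhUnity F 2 ∧ θ.SlotsNondegenerate₁₃ F 2 → θ.Admissible F 2 →
      MatchingUnder (datumOfRecord₁₃SepCoPHV F 2 θ hP v) (DagBinding.EndpointExistence (datumOfRecord₁₃SepCoPHV F 2 θ hP v).C.toB12)) :
    SpineGivenEndpointR13SepCoPHV := fun F θ hP v hG hθ _ _ =>
  (hybridNE7Under_datumOfRecord₁₃SepCoPHV_iff_matchingUnder θ hP v _).mpr (h F θ hP v hG hθ)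

/-- ★★★ **THE READING: K3⁸ `SpineGivenEndpointR13SepCoPHV` ⟺ N19's DECL TARGET AT EVERY GUARDED ADMISSIBLE STAGE-13 TUPLE AND EVERY VERSION SLOT** [bookkeeping] — `N = 2`; tuples `θ` with
provisos `Provisos₁₃SepCoPH`, guard `θ.ZhUnity F 2 ∧ θ.SlotsNondegenerate₁₃ F 2`, admissible; slots `v : Revision₁₃ F 2 θ h`: `T4ApexVariance.MatchingUnder (datumOfRecord₁₃SepCoPHV F 2 θ h v) END` —
per-string matching of consecutive dressed partition functions modulo constants with a summable remainder, NO class decomposition, NO class-uniform constant. [folklore] -/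
theorem spineGivenEndpointR13SepCoPHV_iff_forall_guarded_matchingUnder :
    SpineGivenEndpointR13SepCoPHV ↔ ∀ (F : T4Family) (θ : Stage13HParams F 2) (h : θ.Provisos₁₃SepCoPH F 2) (v : Revision₁₃ F 2 θ h),
      θ.ZhUnity F 2 ∧ θ.SlotsNondegenerate₁₃ F 2 → θ.Admissible F 2 →
        MatchingUnder (datumOfRecord₁₃SepCoPHV F 2 θ h v) (DagBinding.EndpointExistence (datumOfRecord₁₃SepCoPHV F 2 θ h v).C.toB12) :=
  ⟨matchingUnder_datumOfRecord₁₃SepCoPHV_of_spineGivenEndpointR13SepCoPHV, spineGivenEndpointR13SepCoPHV_of_forall_guarded_matchingUnder⟩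

/-! ## §3 In `Spine.NE7.Target` letters -/

/-- ★★ **K3⁸ ⟺ PER-STRING TARGETS UNDER THE PREFIX AT EVERY GUARDED ADMISSIBLE SLOT DATUM** (each string its own radius `l₀ > 0`, volume factor `vol` and summable remainder `δ`):
FILE J v1.1's `hybridNE7Under_iff_stringTargetsUnder` at the slot datum. [folklore] -/
theorem spineGivenEndpointR13SepCoPHV_iff_forall_guarded_stringTargetsUnder :
    SpineGivenEndpointR13SepCoPHV ↔ ∀ (F : T4Family) (θ : Stage13HParams F 2) (h : θ.Provisos₁₃SepCoPH F 2) (v : Revision₁₃ F 2 θ h),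
      θ.ZhUnity F 2 ∧ θ.SlotsNondegenerate₁₃ F 2 → θ.Admissible F 2 →
        (datumOfRecord₁₃SepCoPHV F 2 θ h v).UnderHypotheses (DagBinding.EndpointExistence (datumOfRecord₁₃SepCoPHV F 2 θ h v).C.toB12) fun g₀ =>
          ∀ os : List (ULoop F), ∃ (l₀ vol : ℝ) (δ : ℕ → ℝ), 0 < l₀ ∧
            NE7.Target vol l₀ δ (T4GenFunBounds.schemeZ ((datumOfRecord₁₃SepCoPHV F 2 θ h v).scheme g₀) os) := by
  refine forall₄_congr fun F θ h v => forall₂_congr fun hG hθ => ?_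
  rw [← hybridNE7Under_iff_stringTargetsUnder _ (isPrintedAveraged_datumOfRecord₁₃SepCoPHV F 2 θ h v).avgMeasurable]
  exact ⟨fun hK hB hE => hK hB hE hB hE, fun hK _ _ => hK⟩

/-- ★ **K3⁸ FROM UNIFORM-RADIUS PER-STRING TARGETS** (FILE J §3∕§5's hypothesis shape at the slot datum: along every tuned `g₀` ONE radius `l₀ > 0` serving every string): FILE J v1.1
`hybridNE7Under_of_targetsUnder` at `datumOfRecord₁₃SepCoPHV F 2 θ h v`, then the item (the outer (B)∕END are discarded). [folklore] -/
theorem spineGivenEndpointR13SepCoPHV_of_forall_guarded_targetsUnder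
    (h : ∀ (F : T4Family) (θ : Stage13HParams F 2) (hP : θ.Provisos₁₃SepCoPH F 2) (v : Revision₁₃ F 2 θ hP), θ.ZhUnity F 2 ∧ θ.SlotsNondegenerate₁₃ F 2 → θ.Admissible F 2 →
      (datumOfRecord₁₃SepCoPHV F 2 θ hP v).UnderHypotheses (DagBinding.EndpointExistence (datumOfRecord₁₃SepCoPHV F 2 θ hP v).C.toB12) fun g₀ =>
        ∃ l₀ : ℝ, 0 < l₀ ∧ ∀ os : List (ULoop F), ∃ (vol : ℝ) (δ : ℕ → ℝ),
          NE7.Target vol l₀ δ (T4GenFunBounds.schemeZ ((datumOfRecord₁₃SepCoPHV F 2 θ hP v).scheme g₀) os)) :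
    SpineGivenEndpointR13SepCoPHV := fun F θ hP v hG hθ _ _ =>
  hybridNE7Under_of_targetsUnder _ (isPrintedAveraged_datumOfRecord₁₃SepCoPHV F 2 θ hP v).avgMeasurable (h F θ hP v hG hθ)

/-! ## §4 The statement with its body displayed slot-free -/

/-- ★★ **K3⁸ WITH ITS BODY DISPLAYED SLOT-FREE** [bookkeeping]: the item ⟺ for every guarded admissible `(θ, h)` and EVERY slot `v` — (B) at the SLOT datum → END → the RECORD's tuned
window body in `Target` letters: `∃ γ₀ > 0, ∀ γ ∈ ]0, γ₀], ∃ g₁ > 0, ∀ g ∈ ]0, g₁], ∀ g₀, (datumOfRecord₁₃SepCoPH F 2 θ h).Tuned γ g g₀ →` every string `os` of the RECORD's Wilson scheme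
`(datumOfRecord₁₃SepCoPH F 2 θ h).scheme g₀` has `∃ l₀ > 0, vol, δ` with `Spine.NE7.Target vol l₀ δ (schemeZ … os)` (= `MatchingModConstants ∧ Summable δ`).  DEF-1's `rfl` faces
`underHypotheses_datumOfRecord₁₃SepCoPHV_iff` ∕ `scheme_datumOfRecord₁₃SepCoPHV` over §3: only the antecedent (B) reads the slot. [folklore] -/
theorem spineGivenEndpointR13SepCoPHV_iff_slotAntecedent_recordBody :
    SpineGivenEndpointR13SepCoPHV ↔ ∀ (F : T4Family) (θ : Stage13HParams F 2) (h : θ.Provisos₁₃SepCoPH F 2) (v : Revision₁₃ F 2 θ h),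
      θ.ZhUnity F 2 ∧ θ.SlotsNondegenerate₁₃ F 2 → θ.Admissible F 2 →
        B16.EndStatementBPrinted (datumOfRecord₁₃SepCoPHV F 2 θ h v).C →
          DagBinding.EndpointExistence (datumOfRecord₁₃SepCoPHV F 2 θ h v).C.toB12 →
            ∃ γ₀ : ℝ, 0 < γ₀ ∧ ∀ γ : ℝ, 0 < γ → γ ≤ γ₀ → ∃ g₁ : ℝ, 0 < g₁ ∧ ∀ g : ℝ, 0 < g → g ≤ g₁ →
              ∀ g₀ : ℕ → ℝ, (datumOfRecord₁₃SepCoPH F 2 θ h).Tuned γ g g₀ →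
                ∀ os : List (ULoop F), ∃ (l₀ vol : ℝ) (δ : ℕ → ℝ), 0 < l₀ ∧
                  NE7.Target vol l₀ δ (T4GenFunBounds.schemeZ ((datumOfRecord₁₃SepCoPH F 2 θ h).scheme g₀) os) := by
  rw [spineGivenEndpointR13SepCoPHV_iff_forall_guarded_stringTargetsUnder]
  refine forall₄_congr fun F θ h v => forall₂_congr fun hG hθ => ?_
  rw [underHypotheses_datumOfRecord₁₃SepCoPHV_iff]
  rfl

end Summit.QuantumFields.YangMills.BalabanUVNodes.N19TargetK3R13SepCoPHVReading

end
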